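import Summits.ResolutionOfSingularities.ResolutionOfSingularities.Theorems.EquisingularLiftEquisingularLiftNatHorizChainE1Sections
import HarnessLib

/-!
# [OURS · L1 W4.5(b)] EL♮ line `sections` — WELL-FOUNDED ASSEMBLY of horizontal E1 chains (lead res-L1-w45b-lead-2)
# crux `Theses.EquisingularLift.EquisingularLiftNat` (stmt-ResolutionOfSingularities-20038), skeleton v3
# (stubs `stub_elnat_three_isolated`, `stub_elnat_three_nonisolated`, `stub_elnat_ge_four`)

NOT a statement of any manuscript; OURS plumbing. Every positive rung of the registered research stubs has the shape
«a MEASURE on stages drops under finitely many further admissible steps until the reduced strict transform is regular»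
(le_two: number of non-regular points / total δ; T-ISO-0: length of a given downstairs point-chain; the eventual n = 3
proof: a CJS-type invariant under Δ / COMB / SUB-LIFT / section steps). This file proves that shape ONCE, for horizontal E1
chains over any base `q : P → Spec O` (`O` local) and any measure into a well-founded order:

* `horizChainE1_assembly_of_drop` — if every stage `(X₁, σ₁, S₁)` of the horizontal E1 closure of `(P, 𝟙, Y)` whose reduced
  `V(closure S₁)` is NOT regular admits a further horizontal E1 chain over `(X₁, σ₁ ≫ q, closure S₁)` ending at a stage of
  strictly smaller measure, then some stage has REGULAR reduced strict transform (strong induction on the measure;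
  composition by `horizChainE1_comp`, p502282). With `natChain_and_isIrreducible_of_horizChainE1` (p500485) this is the
  item's conclusion for the fixed ambient.

References: Theorems/EquisingularLiftEquisingularLiftCurveCase.lean (`equisingularLift_of_le_two`, the `key` induction),
…NatStubElnatLeTwo.lean (p498502), …NatHorizChainE1Sections.lean (p502282), …NatHorizChain.lean (p500485).
-/

set_option linter.dupNamespace false -- mandated namespace `Summit.<Summit>.<Problem>` of this single-conjunct summit

noncomputable section

open CategoryTheory CategoryTheory.Limits AlgebraicGeometry TopologicalSpace Topology
open Literature.AlgebraicGeometry.Resolution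
open AlgebraicGeometry.Scheme.IdealSheafData

namespace Summit.ResolutionOfSingularities.ResolutionOfSingularities.Cruxes.EquisingularLiftNat.Sections

/-- **WELL-FOUNDED ASSEMBLY.** Let `O` be local, `q : P → Spec O`, `Y = closure {ξ}`, `μ` a measure on stages with values in
a well-founded order. If every stage of the horizontal E1 closure of `(P, 𝟙, Y)` with NON-regular reduced `V(closure S₁)`
admits a further horizontal E1 chain (over `(X₁, σ₁ ≫ q, closure S₁)`) ending at a stage of strictly smaller measure, then
some stage of the closure has regular reduced strict transform. [folklore; the induction of `equisingularLift_of_le_two`] -/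
theorem horizChainE1_assembly_of_drop {O : Type} [CommRing O] [IsLocalRing O] {P : AlgebraicGeometry.Scheme.{0}} (q : P ⟶ AlgebraicGeometry.Spec (.of O)) {Y : Set P} {ξ : P} (hξ : IsGenericPoint ξ Y) {α : Type} [Preorder α] [WellFoundedLT α] (μ : ∀ X' : AlgebraicGeometry.Scheme.{0}, (X' ⟶ P) → Set X' → α) (drop : ∀ (X₁ : AlgebraicGeometry.Scheme.{0}) (σ₁ : X₁ ⟶ P) (S₁ : Set X₁), (∀ Q : (∀ X' : AlgebraicGeometry.Scheme.{0}, (X' ⟶ P) → Set X' → Prop), Q P (CategoryTheory.CategoryStruct.id P) Y → (∀ (X' X'' : AlgebraicGeometry.Scheme.{0}) (σ' : X' ⟶ P) (Y' : Set X') (C : X'.IdealSheafData) (τ : X'' ⟶ X'), Q X' σ' Y' → Literature.AlgebraicGeometry.Resolution.IsBlowup τ C → Literature.AlgebraicGeometry.Resolution.Scheme.IsRegular C.subscheme → AlgebraicGeometry.Flat (CategoryTheory.CategoryStruct.comp C.subschemeι (CategoryTheory.CategoryStruct.comp σ' q)) → σ' '' (C.support : Set X') ⊆ {x | ¬ IsGenericPoint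 x Y} → (C.support : Set X') ∩ (CategoryTheory.CategoryStruct.comp σ' q) ⁻¹' {IsLocalRing.closedPoint O} ⊆ Y' → Q X'' (CategoryTheory.CategoryStruct.comp τ σ') (closure (τ ⁻¹' (Y' \ (C.support : Set X'))))) → Q X₁ σ₁ S₁) → ¬ Literature.AlgebraicGeometry.Resolution.Scheme.IsRegular (AlgebraicGeometry.Scheme.IdealSheafData.vanishingIdeal (⟨closure S₁, isClosed_closure⟩ : TopologicalSpace.Closeds X₁)).subscheme → ∃ (X₂ : AlgebraicGeometry.Scheme.{0}) (σ₂ : X₂ ⟶ X₁) (S₂ : Set X₂), (∀ Q : (∀ X' : AlgebraicGeometry.Scheme.{0}, (X' ⟶ X₁) → Set X' → Prop), Q X₁ (CategoryTheory.CategoryStruct.id X₁) (closure S₁) → (∀ (X' X'' : AlgebraicGeometry.Scheme.{0}) (σ' : X' ⟶ X₁) (Y' : Set X') (C : X'.IdealSheafData) (τ : X'' ⟶ X'), Q X' σ' Y' → Literature.AlgebraicGeometry.Resolution.IsBlowup τ C → Literature.AlgebraicGeometry.Resolution.Scheme.IsRegular C.subscheme → AlgebraicGeometry.Flat (CategoryTheory.CategoryStruct.comp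 C.subschemeι (CategoryTheory.CategoryStruct.comp σ' (CategoryTheory.CategoryStruct.comp σ₁ q))) → σ' '' (C.support : Set X') ⊆ {x | ¬ IsGenericPoint x (closure S₁)} → (C.support : Set X') ∩ (CategoryTheory.CategoryStruct.comp σ' (CategoryTheory.CategoryStruct.comp σ₁ q)) ⁻¹' {IsLocalRing.closedPoint O} ⊆ Y' → Q X'' (CategoryTheory.CategoryStruct.comp τ σ') (closure (τ ⁻¹' (Y' \ (C.support : Set X'))))) → Q X₂ σ₂ S₂) ∧ μ X₂ (CategoryTheory.CategoryStruct.comp σ₂ σ₁) S₂ < μ X₁ σ₁ S₁) : ∃ (P' : AlgebraicGeometry.Scheme.{0}) (σ : P' ⟶ P) (S' : Set P'), (∀ Q : (∀ X' : AlgebraicGeometry.Scheme.{0}, (X' ⟶ P) → Set X' → Prop), Q P (CategoryTheory.CategoryStruct.id P) Y → (∀ (X' X'' : AlgebraicGeometry.Scheme.{0}) (σ' : X' ⟶ P) (Y' : Set X') (C : X'.IdealSheafData) (τ : X'' ⟶ X'), Q X' σ' Y' → Literature.AlgebraicGeometry.Resolution.IsBlowup τ C → Literature.AlgebraicGeometry.Resolution.Scheme.IsRegular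 C.subscheme → AlgebraicGeometry.Flat (CategoryTheory.CategoryStruct.comp C.subschemeι (CategoryTheory.CategoryStruct.comp σ' q)) → σ' '' (C.support : Set X') ⊆ {x | ¬ IsGenericPoint x Y} → (C.support : Set X') ∩ (CategoryTheory.CategoryStruct.comp σ' q) ⁻¹' {IsLocalRing.closedPoint O} ⊆ Y' → Q X'' (CategoryTheory.CategoryStruct.comp τ σ') (closure (τ ⁻¹' (Y' \ (C.support : Set X'))))) → Q P' σ S') ∧ Literature.AlgebraicGeometry.Resolution.Scheme.IsRegular (AlgebraicGeometry.Scheme.IdealSheafData.vanishingIdeal (⟨closure S', isClosed_closure⟩ : TopologicalSpace.Closeds P')).subscheme := by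
  classical
  -- strong induction on the measure of the current stage, carrying the horizontal E1 chain from `(P, 𝟙, Y)`
  suffices key : ∀ (a : α) (X₁ : Scheme.{0}) (σ₁ : X₁ ⟶ P) (S₁ : Set X₁),
      (∀ Q : (∀ X' : AlgebraicGeometry.Scheme.{0}, (X' ⟶ P) → Set X' → Prop), Q P (CategoryTheory.CategoryStruct.id P) Y → (∀ (X' X'' : AlgebraicGeometry.Scheme.{0}) (σ' : X' ⟶ P) (Y' : Set X') (C : X'.IdealSheafData) (τ : X'' ⟶ X'), Q X' σ' Y' → Literature.AlgebraicGeometry.Resolution.IsBlowup τ C → Literature.AlgebraicGeometry.Resolution.Scheme.IsRegular C.subscheme → AlgebraicGeometry.Flat (CategoryTheory.CategoryStruct.comp C.subschemeι (CategoryTheory.CategoryStruct.comp σ' q)) → σ' '' (C.support : Set X') ⊆ {x | ¬ IsGenericPoint x Y} → (C.support : Set X') ∩ (CategoryTheory.CategoryStruct.comp σ' q) ⁻¹' {IsLocalRing.closedPoint O} ⊆ Y' → Q X'' (CategoryTheory.CategoryStruct.comp τ σ') (closure (τ ⁻¹' (Y' \ (C.support : Set X'))))) → Q X₁ σ₁ S₁)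 →
      μ X₁ σ₁ S₁ = a →
      ∃ (P' : Scheme.{0}) (σ : P' ⟶ P) (S' : Set P'), (∀ Q : (∀ X' : AlgebraicGeometry.Scheme.{0}, (X' ⟶ P) → Set X' → Prop), Q P (CategoryTheory.CategoryStruct.id P) Y → (∀ (X' X'' : AlgebraicGeometry.Scheme.{0}) (σ' : X' ⟶ P) (Y' : Set X') (C : X'.IdealSheafData) (τ : X'' ⟶ X'), Q X' σ' Y' → Literature.AlgebraicGeometry.Resolution.IsBlowup τ C → Literature.AlgebraicGeometry.Resolution.Scheme.IsRegular C.subscheme → AlgebraicGeometry.Flat (CategoryTheory.CategoryStruct.comp C.subschemeι (CategoryTheory.CategoryStruct.comp σ' q)) → σ' '' (C.support : Set X') ⊆ {x | ¬ IsGenericPoint x Y} → (C.support : Set X') ∩ (CategoryTheory.CategoryStruct.comp σ' q) ⁻¹' {IsLocalRing.closedPoint O} ⊆ Y' → Q X'' (CategoryTheory.CategoryStruct.comp τ σ') (closure (τ ⁻¹' (Y' \ (C.support : Set X'))))) → Q P' σ S') ∧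
        Scheme.IsRegular (Scheme.IdealSheafData.vanishingIdeal (⟨closure S', isClosed_closure⟩ : Closeds P')).subscheme from
    key _ P (CategoryStruct.id P) Y (fun Q h0 _ => h0) rfl
  intro a
  induction a using WellFoundedLT.induction with
  | ind a ih =>
    intro X₁ σ₁ S₁ hch₁ ha
    by_cases hreg : Scheme.IsRegular (Scheme.IdealSheafData.vanishingIdeal (⟨closure S₁, isClosed_closure⟩ : Closeds X₁)).subscheme
    · exact ⟨X₁, σ₁, S₁, hch₁, hreg⟩
    · obtain ⟨X₂, σ₂, S₂, hch₂, hlt⟩ := drop X₁ σ₁ S₁ hch₁ hreg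
      have hch' : (∀ Q : (∀ X' : AlgebraicGeometry.Scheme.{0}, (X' ⟶ P) → Set X' → Prop), Q P (CategoryTheory.CategoryStruct.id P) Y → (∀ (X' X'' : AlgebraicGeometry.Scheme.{0}) (σ' : X' ⟶ P) (Y' : Set X') (C : X'.IdealSheafData) (τ : X'' ⟶ X'), Q X' σ' Y' → Literature.AlgebraicGeometry.Resolution.IsBlowup τ C → Literature.AlgebraicGeometry.Resolution.Scheme.IsRegular C.subscheme → AlgebraicGeometry.Flat (CategoryTheory.CategoryStruct.comp C.subschemeι (CategoryTheory.CategoryStruct.comp σ' q)) → σ' '' (C.support : Set X') ⊆ {x | ¬ IsGenericPoint x Y} → (C.support : Set X') ∩ (CategoryTheory.CategoryStruct.comp σ' q) ⁻¹' {IsLocalRing.closedPoint O} ⊆ Y' → Q X'' (CategoryTheory.CategoryStruct.comp τ σ') (closure (τ ⁻¹' (Y' \ (C.support : Set X'))))) → Q X₂ (CategoryStruct.comp σ₂ σ₁) S₂) :=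
        horizChainE1_comp q hξ hch₁ hch₂
      rw [ha] at hlt
      exact ih _ hlt X₂ (CategoryStruct.comp σ₂ σ₁) S₂ hch' rfl

end Summit.ResolutionOfSingularities.ResolutionOfSingularities.Cruxes.EquisingularLiftNat.Sections

end
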